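import Mathlib
import Literature.AlgebraicGeometry.Resolution.LocalBlowup
import Literature.AlgebraicGeometry.Resolution.QuadraticTransforms
import Literature.AlgebraicGeometry.Resolution.QuadraticTransformsRegular
import Literature.AlgebraicGeometry.Resolution.QuadraticTransformsStructure
import Literature.AlgebraicGeometry.Resolution.BlowupRingExceptionalFibre
import Literature.AlgebraicGeometry.Resolution.RegularQuotientIdeal
import Literature.AlgebraicGeometry.Resolution.StrictNormalCrossingsDescent
import Summits.ResolutionOfSingularities.ResolutionOfSingularities.Theorems.RadicialJungCleanModelsLens5PRankTwoCurrency
import HarnessLib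

/-!
# Route `RadicialJung`, crux `CleanModels` (stmt-15917), line `Sketch`: TANGENT-CONE EXIT after one quadratic transform — part 1/2 (prelims)

Helper lemmas (line lead `res-B-lead-1` g10, `--supports stmt-ResolutionOfSingularities-15917`) for the by-hand analysis of the dim-3
research residual at odd `p` recorded in `Cruxes/CleanModels/Lines/Sketch-memo-rev33-residual.md` §3 / lens-5 g19 §5quater: after the printed
base-side phase of Cossart–Piltant 2019 Thm. 1.5 (i) (INPUTS wi-91399, END «multiplicity `< p`», i.e. `max_c ord (g - c^p) ≤ p - 1`) ONE quadratic
transform along the valuation makes the line loosely clean (form (1)) UNLESS the new centre is a SINGULAR point of the projectivised tangent cone of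
`h = g - c^p`.  This module holds the currency-level bricks, all in the vocabulary of `Literature/…/Resolution/{LocalBlowup,QuadraticTransforms}.lean`
and of `Lens5.PRankTwoCurrency.CleanLUConcl`:

* `cleanLUConcl_of_monomial` — EXIT LEMMA FOR FORM (1): a regular finitely generated model carrying a representative `u · ∏ f_i^{a_i}` with `f`
  part of a regular system of parameters (independent modulo `𝔪²`) and `p ∤ a_i` gives `CleanLUConcl`; `cleanLUConcl_of_unit_residue` — form (2).
* `map_maximalIdeal_le_span_chart`, `exists_eq_pow_mul_of_mem_pow` — along a quadratic transform `R → R₁ = (R[𝔪/x])_{𝔪_O ∩ R[𝔪/x]}` one has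
  `𝔪_R R₁ ⊆ x R₁` and `h ∈ 𝔪_R^e ⟹ h = x^e · G` with `G ∈ R₁` (the total transform factors through the exceptional divisor `e` times).
* `notMem_sq_of_isRegularLocalRing_quotient'` (Matsumura 14.2 converse, one element) and `chart_notMem_sq_transform` — THE EXCEPTIONAL PARAMETER:
  for `R` regular local dominated by `O` and `x ∈ 𝔪_R` of minimal value, `x ∉ 𝔪_{R₁}²` in the quadratic transform `R₁` along `O`
  (`R[𝔪/x]/(x) ≅ κ(R)[T]` is a regular ring, Stacks 0BIQ, so `R₁/(x)` is a regular local ring).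

Honest framing: OURS · counted 0 · nothing here proves resolution in characteristic `p` or closes any registered stub; part 2
(`RadicialJungCleanModelsConeExit.lean`) assembles the dichotomy «clean after one quadratic transform, or the centre is a singular point of the cone».
-/

noncomputable section

set_option linter.dupNamespace false

open IsLocalRing
open Literature.AlgebraicGeometry.Resolution
open Summit.ResolutionOfSingularities.ResolutionOfSingularities.Theorems.RadicialJung.CleanModels.Lens5.PRankTwoCurrency

namespace Summit.ResolutionOfSingularities.ResolutionOfSingularities.Theorems.RadicialJung.CleanModels.ConeExit

universe u

/-! ## §1 Exit lemmas: loose clean forms (1) and (2) on a finitely generated model give `CleanLUConcl` -/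

/-- **EXIT LEMMA FOR FORM (1).**  A finitely generated `A ⊆ A'' ⊆ O` whose local ring `R = locAtCentre A'' O` at the centre of `O` is regular,
elements `f₀, …, f_{m-1} ∈ 𝔪_R` (`0 < m`) independent modulo `𝔪_R²` (so part of a regular system of parameters), exponents `a_i` prime to `p`, a unit
`u`, and a NON-TRIVIAL representative `Σ_{j<p} c_j^p g₀^j = u · ∏ f_i^{a_i}` of the `K^p`-line of `g₀`: then `CleanLUConcl p k K O A g₀` holds in form (1)
(complete `f` to a regular system of parameters by `exists_extend_to_rsop`). [folklore] -/
theorem cleanLUConcl_of_monomial {p : ℕ} {k K : Type} [Field k] [Field K] [Algebra k K]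
    (O : ValuationSubring K) (A A'' : Subalgebra k K)
    (hA''O : A''.toSubring ≤ O.toSubring) (hAA'' : A ≤ A'') (hA''fg : A''.FG)
    (hreg : IsRegularLocalRing (locAtCentre A''.toSubring O)) (g₀ : K)
    {m : ℕ} (hm : 0 < m) (f : Fin m → locAtCentre A''.toSubring O)
    (hf : ∀ i, f i ∈ maximalIdeal (locAtCentre A''.toSubring O))
    (hind : ∀ c : Fin m → locAtCentre A''.toSubring O,
      ∑ i, c i * f i ∈ (maximalIdeal (locAtCentre A''.toSubring O)) ^ 2 →
        ∀ i, c i ∈ maximalIdeal (locAtCentre A''.toSubring O))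
    (a : Fin m → ℕ) (ha : ∀ i, ¬ p ∣ a i) (u : locAtCentre A''.toSubring O) (hu : IsUnit u)
    (c : Fin p → K) (hc0 : ∃ j : Fin p, (j : ℕ) ≠ 0 ∧ c j ≠ 0)
    (hc : ∑ j : Fin p, c j ^ p * g₀ ^ (j : ℕ) = (u : K) * ∏ i : Fin m, ((f i : locAtCentre A''.toSubring O) : K) ^ (a i)) :
    CleanLUConcl p k K O A g₀ := by
  classical
  haveI := hreg
  obtain ⟨e, y, hdim, hspan⟩ := exists_extend_to_rsop f hf hind
  -- the full regular system of parameters `t = f ++ y`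
  let t : Fin (m + e) → locAtCentre A''.toSubring O := Fin.append f y
  have hrange : Set.range t = Set.range f ∪ Set.range y := by
    ext z
    constructor
    · rintro ⟨i, rfl⟩
      induction i using Fin.addCases with
      | left j => exact Or.inl ⟨j, by simp [t]⟩
      | right j => exact Or.inr ⟨j, by simp [t]⟩
    · rintro (⟨j, rfl⟩ | ⟨j, rfl⟩)
      · exact ⟨Fin.castAdd e j, by simp [t]⟩
      · exact ⟨Fin.natAdd m j, by simp [t]⟩
  have hspan' : Ideal.span (Set.range t) = maximalIdeal (locAtCentre A''.toSubring O) := by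
    rw [hrange]; exact hspan
  have hmd : m ≤ m + e := Nat.le_add_right m e
  have hcast : ∀ i : Fin m, t (Fin.castLE hmd i) = f i := by
    intro i
    have : Fin.castLE hmd i = Fin.castAdd e i := Fin.ext rfl
    rw [this]
    simp [t]
  refine ⟨A'', hA''O, hAA'', hA''fg, hreg, c, hc0, Or.inl ⟨m + e, m, hmd, t, a, u, hu, hspan', ?_, hm, ha, ?_⟩⟩
  · rw [hdim]
  · rw [hc]
    congr 1
    refine Finset.prod_congr rfl fun i _ => ?_
    rw [hcast]

/-- **EXIT LEMMA FOR FORM (2).**  A finitely generated regular model carrying a representative of the line which is a UNIT whose residue is not a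
`p`-th power gives `CleanLUConcl`. [folklore] -/
theorem cleanLUConcl_of_unit_residue {p : ℕ} {k K : Type} [Field k] [Field K] [Algebra k K]
    (O : ValuationSubring K) (A A'' : Subalgebra k K)
    (hA''O : A''.toSubring ≤ O.toSubring) (hAA'' : A ≤ A'') (hA''fg : A''.FG)
    (hreg : IsRegularLocalRing (locAtCentre A''.toSubring O)) (g₀ : K)
    (u : locAtCentre A''.toSubring O) (hu : IsUnit u)
    (hres : ∀ c' : locAtCentre A''.toSubring O, u - c' ^ p ∉ maximalIdeal (locAtCentre A''.toSubring O))
    (c : Fin p → K) (hc0 : ∃ j : Fin p, (j : ℕ) ≠ 0 ∧ c j ≠ 0)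
    (hc : ∑ j : Fin p, c j ^ p * g₀ ^ (j : ℕ) = (u : K)) :
    CleanLUConcl p k K O A g₀ :=
  ⟨A'', hA''O, hAA'', hA''fg, hreg, c, hc0, Or.inr (Or.inl ⟨u, hu, hc, hres⟩)⟩

/-- Independence modulo `𝔪²` of a single element `x ∈ 𝔪 ∖ 𝔪²` (the `m = 1` input of `cleanLUConcl_of_monomial`). [folklore] -/
theorem independent_single {R : Type*} [CommRing R] [IsLocalRing R] (x : R)
    (hx2 : x ∉ maximalIdeal R ^ 2) :
    ∀ c : Fin 1 → R, ∑ i, c i * (fun _ : Fin 1 => x) i ∈ maximalIdeal R ^ 2 → ∀ i, c i ∈ maximalIdeal R := by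
  intro c hc i
  have hi : i = 0 := Subsingleton.elim i 0
  subst hi
  simp only [Finset.univ_unique, Fin.default_eq_zero, Finset.sum_singleton] at hc
  by_contra hc0
  have hcu : IsUnit (c 0) := by
    by_contra hnu
    exact hc0 ((mem_maximalIdeal _).mpr hnu)
  apply hx2
  obtain ⟨v, hv⟩ := hcu
  have : x = (↑v⁻¹ : R) * (c 0 * x) := by rw [← hv, ← mul_assoc, Units.inv_mul, one_mul]
  rw [this]
  exact Ideal.mul_mem_left _ _ hc

/-- Independence modulo `𝔪²` of a pair `(x, G)` with `x ∉ 𝔪²`, `G ∈ 𝔪` and `G ∉ 𝔪² + (x)` (the `m = 2` input of `cleanLUConcl_of_monomial`: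
the exceptional parameter and a TRANSVERSAL strict factor). [folklore] -/
theorem independent_pair {R : Type*} [CommRing R] [IsLocalRing R] (x G : R)
    (hx2 : x ∉ maximalIdeal R ^ 2) (hG : G ∈ maximalIdeal R)
    (hGt : G ∉ maximalIdeal R ^ 2 ⊔ Ideal.span {x}) :
    ∀ c : Fin 2 → R, ∑ i, c i * ![x, G] i ∈ maximalIdeal R ^ 2 → ∀ i, c i ∈ maximalIdeal R := by
  intro c hc
  rw [Fin.sum_univ_two] at hc
  simp only [Matrix.cons_val_zero, Matrix.cons_val_one] at hc
  -- first `c 1 ∈ 𝔪`, else `G ∈ 𝔪² + (x)`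
  have hc1 : c 1 ∈ maximalIdeal R := by
    by_contra hc1
    have hcu : IsUnit (c 1) := by
      by_contra hnu
      exact hc1 ((mem_maximalIdeal _).mpr hnu)
    obtain ⟨v, hv⟩ := hcu
    apply hGt
    have hGeq : G = (↑v⁻¹ : R) * (c 0 * x + c 1 * G) - (↑v⁻¹ : R) * c 0 * x := by
      rw [← hv]
      have h1 : (↑v⁻¹ : R) * (↑v : R) = 1 := Units.inv_mul v
      linear_combination (-(G : R)) * h1
    rw [hGeq]
    refine Ideal.sub_mem _ (Ideal.mem_sup_left (Ideal.mul_mem_left _ _ hc)) (Ideal.mem_sup_right ?_)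
    exact Ideal.mul_mem_left _ _ (Ideal.mem_span_singleton_self x)
  -- then `c 0 x ∈ 𝔪²`, so `c 0 ∈ 𝔪`
  have hc1G : c 1 * G ∈ maximalIdeal R ^ 2 := by
    rw [pow_two]; exact Ideal.mul_mem_mul hc1 hG
  have hc0x : c 0 * x ∈ maximalIdeal R ^ 2 := by
    have := Ideal.sub_mem _ hc hc1G
    rwa [add_sub_cancel_right] at this
  have hc0 : c 0 ∈ maximalIdeal R := by
    by_contra hc0
    have hcu : IsUnit (c 0) := by
      by_contra hnu
      exact hc0 ((mem_maximalIdeal _).mpr hnu)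
    apply hx2
    obtain ⟨v, hv⟩ := hcu
    have : x = (↑v⁻¹ : R) * (c 0 * x) := by rw [← hv, ← mul_assoc, Units.inv_mul, one_mul]
    rw [this]
    exact Ideal.mul_mem_left _ _ hc0x
  intro i
  fin_cases i
  · exact hc0
  · exact hc1

/-- **FORM (1), ONE PARAMETER**: a representative `u · x^e` with `u` a unit, `x ∈ 𝔪 ∖ 𝔪²` and `p ∤ e` on a regular finitely generated model gives
`CleanLUConcl` (the case «new centre OFF the tangent cone»). [folklore] -/
theorem cleanLUConcl_of_unit_mul_pow {p : ℕ} {k K : Type} [Field k] [Field K] [Algebra k K]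
    (O : ValuationSubring K) (A A'' : Subalgebra k K)
    (hA''O : A''.toSubring ≤ O.toSubring) (hAA'' : A ≤ A'') (hA''fg : A''.FG)
    (hreg : IsRegularLocalRing (locAtCentre A''.toSubring O)) (g₀ : K)
    (x : locAtCentre A''.toSubring O) (hx : x ∈ maximalIdeal (locAtCentre A''.toSubring O))
    (hx2 : x ∉ maximalIdeal (locAtCentre A''.toSubring O) ^ 2)
    (u : locAtCentre A''.toSubring O) (hu : IsUnit u) (e : ℕ) (he : ¬ p ∣ e)
    (c : Fin p → K) (hc0 : ∃ j : Fin p, (j : ℕ) ≠ 0 ∧ c j ≠ 0)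
    (hc : ∑ j : Fin p, c j ^ p * g₀ ^ (j : ℕ) = (u : K) * (x : K) ^ e) :
    CleanLUConcl p k K O A g₀ := by
  refine cleanLUConcl_of_monomial O A A'' hA''O hAA'' hA''fg hreg g₀ Nat.one_pos (fun _ => x) (fun _ => hx)
    (independent_single x hx2) (fun _ => e) (fun _ => he) u hu c hc0 ?_
  rw [hc]
  simp

/-- **FORM (1), TWO PARAMETERS**: a representative `u · x^e · G` with `u` a unit, `x ∉ 𝔪²`, `G ∈ 𝔪 ∖ (𝔪² + (x))` (so `(x, G)` is part of a regular
system of parameters) and `p ∤ e` on a regular finitely generated model gives `CleanLUConcl` (the case «new centre a REGULAR point of the tangent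
cone», for `p ≠ 1`). [folklore] -/
theorem cleanLUConcl_of_unit_mul_pow_mul {p : ℕ} (hp : p.Prime) {k K : Type} [Field k] [Field K] [Algebra k K]
    (O : ValuationSubring K) (A A'' : Subalgebra k K)
    (hA''O : A''.toSubring ≤ O.toSubring) (hAA'' : A ≤ A'') (hA''fg : A''.FG)
    (hreg : IsRegularLocalRing (locAtCentre A''.toSubring O)) (g₀ : K)
    (x : locAtCentre A''.toSubring O) (hx : x ∈ maximalIdeal (locAtCentre A''.toSubring O))
    (hx2 : x ∉ maximalIdeal (locAtCentre A''.toSubring O) ^ 2)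
    (G : locAtCentre A''.toSubring O) (hG : G ∈ maximalIdeal (locAtCentre A''.toSubring O))
    (hGt : G ∉ maximalIdeal (locAtCentre A''.toSubring O) ^ 2 ⊔ Ideal.span {x})
    (u : locAtCentre A''.toSubring O) (hu : IsUnit u) (e : ℕ) (he : ¬ p ∣ e)
    (c : Fin p → K) (hc0 : ∃ j : Fin p, (j : ℕ) ≠ 0 ∧ c j ≠ 0)
    (hc : ∑ j : Fin p, c j ^ p * g₀ ^ (j : ℕ) = (u : K) * (x : K) ^ e * (G : K)) :
    CleanLUConcl p k K O A g₀ := by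
  have h1 : ¬ p ∣ 1 := fun h => hp.one_lt.ne' (Nat.dvd_one.mp h)
  refine cleanLUConcl_of_monomial O A A'' hA''O hAA'' hA''fg hreg g₀ Nat.two_pos ![x, G]
    (fun i => by fin_cases i <;> simp [hx, hG]) (independent_pair x G hx2 hG hGt) ![e, 1]
    (fun i => by fin_cases i <;> simp [he, h1]) u hu c hc0 ?_
  rw [hc, Fin.prod_univ_two]
  simp [mul_assoc]

/-! ## §2 The chart element along a quadratic transform -/

/-- **`𝔪_R · R₁ ⊆ x · R₁`** along the quadratic transform `R₁ ⊇ R[𝔪_R/x]`: every `y ∈ 𝔪_R` is `x · (y/x)` with `y/x ∈ R[𝔪_R/x]`. [folklore] -/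
theorem map_maximalIdeal_le_span_chart {K : Type u} [Field K] {R R₁ : Subring K} [IsLocalRing R]
    {x : R} (hx0 : (x : K) ≠ 0) (hT : blowupRing R (x : K) ≤ R₁) :
    (maximalIdeal R).map (Subring.inclusion ((le_blowupRing R (x : K)).trans hT)) ≤
      Ideal.span {(⟨(x : K), hT (le_blowupRing R (x : K) x.2)⟩ : R₁)} := by
  rw [Ideal.map_le_iff_le_comap]
  intro y hy
  rw [Ideal.mem_comap, Ideal.mem_span_singleton']
  refine ⟨⟨(y : K) / x, hT (div_mem_blowupRing (x : K) hy)⟩, Subtype.ext ?_⟩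
  change (y : K) / x * x = y
  rw [div_mul_cancel₀ _ hx0]

/-- **`h ∈ 𝔪_R^e ⟹ h = x^e · G` in the transform** (`G` = the `e`-fold strict factor of `h` through the exceptional divisor `x = 0`). [folklore] -/
theorem exists_eq_pow_mul_of_mem_pow {K : Type u} [Field K] {R R₁ : Subring K} [IsLocalRing R]
    {x : R} (hx0 : (x : K) ≠ 0) (hT : blowupRing R (x : K) ≤ R₁) {e : ℕ} {h : R}
    (hh : h ∈ maximalIdeal R ^ e) :
    ∃ G : R₁, (h : K) = (x : K) ^ e * (G : K) := by
  set ι : R →+* R₁ := Subring.inclusion ((le_blowupRing R (x : K)).trans hT) with hι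
  set xR₁ : R₁ := ⟨(x : K), hT (le_blowupRing R (x : K) x.2)⟩ with hxR₁
  have hmap : (maximalIdeal R ^ e).map ι ≤ Ideal.span {xR₁ ^ e} := by
    rw [Ideal.map_pow, ← Ideal.span_singleton_pow]
    exact Ideal.pow_right_mono (map_maximalIdeal_le_span_chart hx0 hT) e
  have hmem : ι h ∈ Ideal.span {xR₁ ^ e} := hmap (Ideal.mem_map_of_mem ι hh)
  obtain ⟨G, hG⟩ := Ideal.mem_span_singleton'.mp hmem
  refine ⟨G, ?_⟩
  have h1 := congrArg (fun z : R₁ => (z : K)) hG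
  simp only [Subring.coe_mul, SubmonoidClass.coe_pow] at h1
  have h2 : ((ι h : R₁) : K) = (h : K) := rfl
  have h3 : ((xR₁ : R₁) : K) = (x : K) := rfl
  rw [h2, h3] at h1
  rw [← h1, mul_comm]

/-! ## §3 The exceptional parameter is a regular parameter of the transform -/

/-- **Converse of Matsumura 14.2 for one element** (local copy of the tree's `notMem_sq_of_isRegularLocalRing_quotient`, to keep the imports light):
in a regular local ring `R`, if `a ∈ 𝔪`, `a ≠ 0` and `R/(a)` is regular, then `a ∉ 𝔪²`. [cite: Matsumura1987, Thm. 14.2] -/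
theorem notMem_sq_of_isRegularLocalRing_quotient' {R : Type u} [CommRing R] [IsRegularLocalRing R]
    {a : R} (ha : a ∈ maximalIdeal R) (ha0 : a ≠ 0)
    [IsRegularLocalRing (R ⧸ Ideal.span {a})] : a ∉ maximalIdeal R ^ 2 := by
  have hJ : Ideal.span {a} ≤ maximalIdeal R := (Ideal.span_singleton_le_iff_mem _).mpr ha
  obtain ⟨c, f, hfG, hspan, hli⟩ := exists_span_eq_of_isRegularLocalRing_quotient hJ ({a} : Set R) rfl
  cases c with
  | zero =>
    exfalso
    have : Ideal.span (Set.range f) = ⊥ := by rw [Set.range_eq_empty, Ideal.span_empty]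
    rw [this, eq_comm, Ideal.span_singleton_eq_bot] at hspan
    exact ha0 hspan
  | succ c =>
    have hf0 : f 0 = a := hfG 0
    have hne := hli.ne_zero 0
    rw [Ne, Ideal.toCotangent_eq_zero] at hne
    simpa [hf0] using hne

/-- **`B_𝔭 / x B_𝔭` is a regular local ring when `B/(x)` is a regular ring**, for `B_𝔭` given as ANY localisation `S` of `B` at the prime `𝔭 ∋ x`
(here `S = locAtCentre B O`): `S/(x)` is the localisation of `B/(x)` at `𝔭/(x)`.  Verbatim the inner step of the tree's
`isRegularLocalRing_localization_of_mem_of_quotient` (`BlowupChartRegular.lean`), stated for an abstract localisation. [folklore] -/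
theorem isRegularLocalRing_quotient_of_isLocalization {B S : Type u} [CommRing B] [CommRing S] [Algebra B S]
    [IsNoetherianRing B] {a : B} [hreg : IsRegularRing (B ⧸ Ideal.span {a})] (Q : Ideal B) [Q.IsPrime] (hQ : a ∈ Q)
    [IsLocalization.AtPrime S Q] :
    IsRegularLocalRing (S ⧸ Ideal.span {algebraMap B S a}) := by
  set J : Ideal B := Ideal.span {a} with hJ
  have hJQ : J ≤ Q := (Ideal.span_singleton_le_iff_mem _).mpr hQ
  set Qbar : Ideal (B ⧸ J) := Q.map (Ideal.Quotient.mk J) with hQbar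
  have hcomap : Qbar.comap (Ideal.Quotient.mk J) = Q := by
    rw [hQbar, Ideal.comap_map_of_surjective _ Ideal.Quotient.mk_surjective,
      ← RingHom.ker_eq_comap_bot, Ideal.mk_ker, sup_eq_left]
    exact hJQ
  haveI hQbarp : Qbar.IsPrime :=
    Ideal.map_isPrime_of_surjective Ideal.Quotient.mk_surjective (by rwa [Ideal.mk_ker])
  have hmemQ : ∀ c : B, Ideal.Quotient.mk J c ∈ Qbar ↔ c ∈ Q := fun c => by
    rw [← Ideal.mem_comap, hcomap]
  have hM : Algebra.algebraMapSubmonoid (B ⧸ J) Q.primeCompl = Qbar.primeCompl := by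
    ext b
    constructor
    · rintro ⟨c, hc, rfl⟩
      exact fun h => hc ((hmemQ c).mp h)
    · intro hb
      obtain ⟨c, rfl⟩ := Ideal.Quotient.mk_surjective b
      exact ⟨c, fun h => hb ((hmemQ c).mpr h), rfl⟩
  haveI : IsLocalization.AtPrime (S ⧸ J.map (algebraMap B S)) Qbar := by
    have := (inferInstance : IsLocalization (Algebra.algebraMapSubmonoid (B ⧸ J) Q.primeCompl)
      (S ⧸ J.map (algebraMap B S)))
    rwa [hM] at this
  have e := (IsLocalization.algEquiv Qbar.primeCompl (S ⧸ J.map (algebraMap B S)) (Localization.AtPrime Qbar)).toRingEquiv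
  haveI : IsRegularLocalRing (S ⧸ J.map (algebraMap B S)) := IsRegularLocalRing.of_ringEquiv e.symm
  have hJt : J.map (algebraMap B S) = Ideal.span {algebraMap B S a} := by
    rw [hJ, Ideal.map_span, Set.image_singleton]
  exact IsRegularLocalRing.of_ringEquiv (Ideal.quotEquivOfEq hJt)

/-- **THE EXCEPTIONAL PARAMETER IS A REGULAR PARAMETER OF THE TRANSFORM.**  Let `R ⊆ K` be a regular local ring dominated by the valuation ring `O`,
`x ∈ 𝔪_R` nonzero of minimal value among the elements of `𝔪_R`, and `R₁ = (R[𝔪_R/x])_{𝔪_O ∩ R[𝔪_R/x]}` the quadratic transform of `R` along `O`.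
Then `x ∉ 𝔪_{R₁}²`.  Proof: `x ∉ 𝔪_R²` (`IsQuadraticTransform.chart_not_mem_sq`), so `R[𝔪_R/x]/(x) ≅ κ(R)[T_j]` is a regular ring
(`isRegularRing_blowupRing_quotient`, Stacks 0BIQ), hence `R₁/(x)` is a regular local ring (`isRegularLocalRing_quotient_of_isLocalization`), and
`R₁` is regular (`IsQuadraticTransformAlong.isRegularLocalRing_of_isRegularLocalRing`); conclude by `notMem_sq_of_isRegularLocalRing_quotient'`.
[cite: StacksProject, Tag 0BIQ] [cite: Matsumura1987, Thm. 14.2] -/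
theorem chart_notMem_sq_transform {K : Type u} [Field K] {O : ValuationSubring K} {R R₁ : Subring K}
    [IsRegularLocalRing R] (hq : IsQuadraticTransformAlong O R R₁) (hdom : SubringDominates R O.toSubring)
    (x : R) (hx : x ∈ maximalIdeal R) (hx0 : x ≠ 0) (hmin : ∀ y ∈ maximalIdeal R, O.valuation (y : K) ≤ O.valuation (x : K)) :
    ∃ hxR₁ : (x : K) ∈ R₁, (haveI := hq.isLocalRing;
      (⟨(x : K), hxR₁⟩ : R₁) ∈ maximalIdeal R₁ ∧ (⟨(x : K), hxR₁⟩ : R₁) ∉ maximalIdeal R₁ ^ 2) := by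
  classical
  haveI := hq.isLocalRing
  have hRO := hq.source_le
  have hx0K : (x : K) ≠ 0 := fun h => hx0 (Subtype.ext h)
  -- `R₁` is the transform in the `x`-chart
  obtain ⟨_, s, hs⟩ := hq.fg_maximalIdeal
  have hspan : Ideal.span (↑(insert x s) : Set R) = maximalIdeal R := by
    rw [Finset.coe_insert, Ideal.span_insert, hs, sup_eq_right]
    exact (Ideal.span_singleton_le_iff_mem _).mpr hx
  have hq' : IsQuadraticTransformAlong O R (locAtCentre (blowupRing R (x : K)) O) := by
    refine ⟨‹_›, hRO, insert x s, x, hspan, Finset.mem_insert_self _ _, hx0, ?_, ?_⟩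
    · intro y hy
      exact hmin y (hspan ▸ Ideal.subset_span (Finset.mem_coe.mpr hy))
    · rw [blowupRing_eq_closure_of_span_eq (x : K) _ hspan]
  have hR₁eq : R₁ = locAtCentre (blowupRing R (x : K)) O := hq.unique hq'
  set B : Subring K := blowupRing R (x : K) with hBdef
  have hBR₁ : B ≤ R₁ := hR₁eq ▸ le_locAtCentre B O
  have hBO : B ≤ O.toSubring := hBR₁.trans hq.target_le
  have hxB : (x : K) ∈ B := le_blowupRing R (x : K) x.2
  have hxR₁ : (x : K) ∈ R₁ := hBR₁ hxB
  refine ⟨hxR₁, ?_, ?_⟩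
  · -- domination: `x ∈ 𝔪_R ⊆ 𝔪_{R₁}`
    have hdom₁ : SubringDominates R R₁ := (hq.isQuadraticTransform hdom).dominates
    exact (incl_mem_maximalIdeal_iff hdom₁ x).mpr hx
  · -- `x ∉ 𝔪_R²`
    have hdomR₁ : SubringDominates R R₁ := (hq.isQuadraticTransform hdom).dominates
    have hx2R : x ∉ maximalIdeal R ^ 2 := IsQuadraticTransform.chart_not_mem_sq hBR₁ hdomR₁ hx0
    -- `R[𝔪/x]` is a regular (hence Noetherian) ring
    have hd0 : 0 < (maximalIdeal R).spanFinrank := by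
      rw [pos_iff_ne_zero, Ne, Submodule.spanFinrank_eq_zero_iff_eq_bot (IsNoetherian.noetherian _)]
      intro hbot
      rw [hbot] at hx
      exact hx0 ((Submodule.mem_bot _).mp hx)
    obtain ⟨z, hz, hz0⟩ := exists_rsop_apply_eq rfl hx hx2R ⟨0, hd0⟩
    haveI hBreg : IsRegularRing B := by
      have h := isRegularRing_blowupRing R rfl z hz ⟨0, hd0⟩
      rwa [hz0] at h
    -- `B/(x)` is a regular ring
    haveI hBq : IsRegularRing (B ⧸ Ideal.span {(⟨(x : K), hxB⟩ : B)}) :=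
      isRegularRing_blowupRing_quotient R x.2 (by simpa using hx) (by simpa using hx2R) hx0K
    -- `R₁ = locAtCentre B O` is the localisation of `B` at the centre, which contains `x`
    haveI := isLocalization_locAtCentre (K := K) (O := O) hBO
    have hvx : O.valuation (x : K) < 1 :=
      ((subringDominates_valuationSubring_iff hRO).mp hdom x).mp hx
    have hxcentre : (⟨(x : K), hxB⟩ : B) ∈ subringCentre B O hBO := by
      rw [mem_subringCentre_iff]
      exact hvx
    have hreg1 : IsRegularLocalRing
        (locAtCentre B O ⧸ Ideal.span {algebraMap B (locAtCentre B O) ⟨(x : K), hxB⟩}) :=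
      isRegularLocalRing_quotient_of_isLocalization (B := B) (S := locAtCentre B O)
        (subringCentre B O hBO) hxcentre
    -- transport to `R₁` and conclude
    haveI hR₁reg : IsRegularLocalRing R₁ := hq.isRegularLocalRing_of_isRegularLocalRing ‹_›
    have hxm₁ : (⟨(x : K), hxR₁⟩ : R₁) ∈ maximalIdeal R₁ := (incl_mem_maximalIdeal_iff hdomR₁ x).mpr hx
    clear_value B
    subst hBdef
    subst hR₁eq
    have halg : algebraMap (blowupRing R (x : K)) (locAtCentre (blowupRing R (x : K)) O) ⟨(x : K), hxB⟩ =
        ⟨(x : K), hxR₁⟩ := Subtype.ext rfl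
    rw [halg] at hreg1
    haveI := hreg1
    exact notMem_sq_of_isRegularLocalRing_quotient' (R := locAtCentre (blowupRing R (x : K)) O)
      hxm₁ (fun h => hx0K (congrArg Subtype.val h))

end Summit.ResolutionOfSingularities.ResolutionOfSingularities.Theorems.RadicialJung.CleanModels.ConeExit

end
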